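import Summits.CriticalPhenomena.PercolationContinuityZ3.Theorems.Transplant.Slab111HubXAcc
import HarnessLib

/-!
# The HUB ROUTING of the `(111)`-films, XXX-X: the REALISABILITY RULES of the zone-free dispatcher as a formula, from `Terminals`

builds on p205010 (kernel theorem, internal audit signed; external expert review pending) — NOT used in this file.  Lane `prim-bschramm`, seat
`prim-bschramm-p2` (gen 37; class C1b; memo `HOME/bschramm/P2-LATTICES.md` §135); helper file (`--supports stmt-CriticalPhenomena-4575 --as helper`).
What «HexShadowVRouteData».`Terminals` says about the level pattern of a certified triple at a block of a valid shape («Slab111HubShape»), as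
ONE «Slab111HubXLang» formula `rulesFm S q₁ q₂ q₃` (§1): the terminals are members (not bad boundary vertices), `E₁ ≠ E₂`, and for `E₁`, `E₂` the
witnesses of `Terminals.nbrs` — an EXIT `o` (a film neighbour outside the cleared set, inside the window, off the column of `w'`) and a second
window neighbour `a` (off the column of `w'`, `a ≠ o`, `a ≠` the other terminal) — in relative coordinates (`ruleTD`).  §2 **`rulesFm_sound`**:
the formula holds at the pattern of every certified triple.  The decision trees of «Slab111HubXTree» may discard boxes on which a conjunct of
the rules fails.
[cite: DuminilCopinSidoraviciusTassion2016, §2.3 (proof of Fact 2: the three disjoint paths γ_u, γ_v, γ_w in B_R(z))]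
-/

noncomputable section

namespace Summit.CriticalPhenomena.PercolationContinuityZ3.Theorems.Transplant

open Literature.Probability.Percolation Literature.Probability.LatticeModels SimpleGraph
open scoped Classical

namespace Slab111

variable {k : ℕ}

/-! ## §1 The rules formula -/

/-- The relative neighbours of a column: `(q + u, +1)` and `(q − u, −1)` for the three up-steps `u`. [folklore] -/
def relNbrs (q : ℤ × ℤ) : List ((ℤ × ℤ) × ℤ) :=
  [((q.1 + 1, q.2), 1), ((q.1, q.2 - 1), 1), ((q.1 - 1, q.2 + 1), 1), ((q.1 - 1, q.2), -1), ((q.1, q.2 + 1), -1), ((q.1 + 1, q.2 - 1), -1)]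

/-- The atom "the level `nᵢ + s` exists" (`s = ±1`): `nᵢ − 1 ≥ 0` or `nᵢ + 1 ≤ k`. [folklore] -/
def existsA (i : ℕ) (s : ℤ) : Atom := if s = 1 then leKA i 1 else ge0A i (-1)

/-- The clause "the vertex over column `c` at level `nᵢ + s` is outside the cleared set", for a cleared column `c`: it is a bad boundary
vertex (`none` when the column is never bad, i.e. the vertex is always a member). [folklore] -/
def outsideC (S : ShapeB) (i : ℕ) (c : ℤ × ℤ) (s : ℤ) : Option (List Atom) :=
  if S.colsB c = false then some [] else
    if S.badBot c = true ∨ S.badTop c = true then some ((if S.badBot c then [eq0A i s] else []) ++ (if S.badTop c then [eqKA i s] else []))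
    else none

/-- **Rule T for terminal `i ∈ {1, 2}`** (column `q`, the other `E`-terminal `j` over `qj`, `w'` over `q₃`): some exit `o` and second neighbour
`a` as certified by `Terminals.nbrs`, as a disjunction of cubes over the choices of `(o, a)` among the six relative neighbours. [folklore] -/
def ruleTD (S : ShapeB) (i j : ℕ) (q qj q₃ : ℤ × ℤ) : List (List (List Atom)) :=
  (relNbrs q).flatMap fun o => (relNbrs q).flatMap fun a =>
    if o = a ∨ S.inwinB o.1 = false ∨ o.1 = q₃ ∨ S.inwinB a.1 = false ∨ a.1 = q₃ then [] else
      match outsideC S i o.1 o.2 with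
      | none => []
      | some cl =>
        [(if cl = [] then [] else [cl]) ++ [[existsA i o.2], [existsA i a.2]] ++ (if a.1 = qj then neQ (i, a.2) (j, 0) else [])]

/-- Membership conjuncts of a terminal over column `q` (not a bad boundary vertex). [folklore] -/
def memFm (S : ShapeB) (i : ℕ) (q : ℤ × ℤ) : Fm :=
  (if S.badBot q then [[[[ne0A i 0]]]] else []) ++ (if S.badTop q then [[[[neKA i 0]]]] else [])

/-- **The rules formula** of a key. [folklore] -/
def rulesFm (S : ShapeB) (q₁ q₂ q₃ : ℤ × ℤ) : Fm :=
  memFm S 1 q₁ ++ memFm S 2 q₂ ++ memFm S 3 q₃ ++ (if q₁ = q₂ then [[neQ (1, 0) (2, 0)]] else []) ++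
    [ruleTD S 1 2 q₁ q₂ q₃, ruleTD S 2 1 q₂ q₁ q₃]

/-! ## §2 Soundness from `Terminals` -/

section Complete

variable {n₁ n₂ n₃ k : ℤ} (h1 : 0 ≤ n₁ ∧ n₁ ≤ k) (h2 : 0 ≤ n₂ ∧ n₂ ≤ k) (h3 : 0 ≤ n₃ ∧ n₃ ≤ k)
include h1 h2 h3

omit h1 h2 h3 in
/-- The value behind the bottom / top coordinate of terminal `i`, read off the pattern. [folklore] -/
theorem get_bdry {i : ℕ} (hi : i = 1 ∨ i = 2 ∨ i = 3) :
    (patOf n₁ n₂ n₃ k).get (botC i) = min XB (LvT.val n₁ n₂ n₃ (i, 0)) ∧ (patOf n₁ n₂ n₃ k).get (topC i) = min XB (k - LvT.val n₁ n₂ n₃ (i, 0)) := by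
  rcases hi with rfl | rfl | rfl <;> simp [patOf, Pat.get, botC, topC, LvT.val]

/-- **Completeness of the membership atoms at small offsets**: if `nᵢ + x ≠ 0` (`|x| ≤ 1`) then `ne0A` holds, etc. [folklore] -/
theorem bdry_complete {i : ℕ} (hi : i = 1 ∨ i = 2 ∨ i = 3) {x : ℤ} (hx : -1 ≤ x ∧ x ≤ 1) :
    (LvT.val n₁ n₂ n₃ (i, x) ≠ 0 → (ne0A i x).eval (patOf n₁ n₂ n₃ k) = true) ∧
    (LvT.val n₁ n₂ n₃ (i, x) ≠ k → (neKA i x).eval (patOf n₁ n₂ n₃ k) = true) ∧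
    (LvT.val n₁ n₂ n₃ (i, x) = 0 → (eq0A i x).eval (patOf n₁ n₂ n₃ k) = true) ∧
    (LvT.val n₁ n₂ n₃ (i, x) = k → (eqKA i x).eval (patOf n₁ n₂ n₃ k) = true) ∧
    (0 ≤ LvT.val n₁ n₂ n₃ (i, x) → (ge0A i x).eval (patOf n₁ n₂ n₃ k) = true) ∧
    (LvT.val n₁ n₂ n₃ (i, x) ≤ k → (leKA i x).eval (patOf n₁ n₂ n₃ k) = true) := by
  obtain ⟨gb, gt⟩ := get_bdry (n₁ := n₁) (n₂ := n₂) (n₃ := n₃) (k := k) hi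
  have vx : LvT.val n₁ n₂ n₃ (i, x) = LvT.val n₁ n₂ n₃ (i, 0) + x := by unfold LvT.val; simp only; ring
  have hv : 0 ≤ LvT.val n₁ n₂ n₃ (i, 0) ∧ LvT.val n₁ n₂ n₃ (i, 0) ≤ k := by
    unfold LvT.val; rcases hi with rfl | rfl | rfl <;> simp <;> omega
  unfold Atom.eval ne0A neKA eq0A eqKA ge0A leKA Atom.evalV
  simp only [gb, gt, decide_eq_true_eq]
  unfold XB
  refine ⟨fun h => ?_, fun h => ?_, fun h => ?_, fun h => ?_, fun h => ?_, fun h => ?_⟩ <;> rw [vx] at h <;> omega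

omit h1 h2 h3 in
/-- **Completeness of `neQ` for adjacent-level comparisons**: if `nᵢ + x ≠ n_j` (`|x| ≤ 1`, `i ≠ j`) then the cube `neQ (i,x) (j,0)` holds. [folklore] -/
theorem neQ_complete {i j : ℕ} (hi : i = 1 ∨ i = 2 ∨ i = 3) (hj : j = 1 ∨ j = 2 ∨ j = 3) (hij : i ≠ j) {x : ℤ} (hx : -1 ≤ x ∧ x ≤ 1)
    (h : LvT.val n₁ n₂ n₃ (i, x) ≠ LvT.val n₁ n₂ n₃ (j, 0)) : evalQ (patOf n₁ n₂ n₃ k) (neQ (i, x) (j, 0)) = true := by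
  unfold neQ
  rw [if_neg (by exact hij)]
  unfold evalQ evalC
  simp only [List.all_cons, List.all_nil, List.any_cons, List.any_nil, Bool.or_false, Bool.and_true, Bool.or_eq_true]
  unfold LvT.val at h
  unfold dgtAtom Atom.eval Atom.evalV
  rcases hi with rfl | rfl | rfl <;> rcases hj with rfl | rfl | rfl <;>
    simp only [and_true, and_false, if_true, if_false, show ¬((1:ℕ) = 2) by omega, show ¬((1:ℕ) = 3) by omega,
      show ¬((2:ℕ) = 1) by omega, show ¬((2:ℕ) = 3) by omega, show ¬((3:ℕ) = 1) by omega, show ¬((3:ℕ) = 2) by omega,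
      patOf, Pat.get, decide_eq_true_eq] at h hij ⊢ <;>
    first | exact absurd rfl hij | (unfold clampZ XM; omega)

end Complete

/-- The relative neighbours are the film neighbours. [folklore] -/
theorem mem_relNbrs_of_adj {z : Site 2} {x y : slab111 k} (h : (film k).Adj x y) :
    (relC z y, lev (y : Site 3) - lev (x : Site 3)) ∈ relNbrs (relC z x) := by
  obtain ⟨u, hu, hn⟩ := nbr_relC (z := z) h
  unfold relNbrs UPS at *
  simp only [List.mem_cons, List.mem_nil_iff, or_false] at hu
  rcases hn with ⟨hc, hl⟩ | ⟨hc, hl⟩ <;> rcases hu with rfl | rfl | rfl <;>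
    simp only [hc, hl, List.mem_cons, List.mem_nil_iff, or_false, Prod.mk.injEq, add_zero, sub_zero, add_sub_cancel_left,
      sub_sub_cancel_left] <;> simp <;> omega

set_option maxHeartbeats 2000000 in
/-- **Rule T from `Terminals`**: for `E = Eᵢ` with exit `o` and second neighbour `a` as in `Terminals.nbrs`, the disjunction `ruleTD` holds at the
pattern. [folklore] -/
theorem ruleTD_sound {S : ShapeB} {tR tD sR sD : ℕ} (hV : S.Valid tR tD sR sD) {z : Site 2} {E Ej w' o a : slab111 k}
    {n₁ n₂ n₃ : ℤ} (h1 : 0 ≤ n₁ ∧ n₁ ≤ k) (h2 : 0 ≤ n₂ ∧ n₂ ≤ k) (h3 : 0 ≤ n₃ ∧ n₃ ≤ k) {i j : ℕ} (hi : i = 1 ∨ i = 2 ∨ i = 3)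
    (hj : j = 1 ∨ j = 2 ∨ j = 3) (hij : i ≠ j) (hEi : LvT.val n₁ n₂ n₃ (i, 0) = lev (E : Site 3)) (hEj : LvT.val n₁ n₂ n₃ (j, 0) = lev (Ej : Site 3))
    (hoE : (film k).Adj E o) (hEa : (film k).Adj E a) (ho : o ∉ WOf S k z) (hwo : HexShadow.InWin z tD sR ((hexShadow k).sh o))
    (hwa : HexShadow.InWin z tD sR ((hexShadow k).sh a)) (hao : a ≠ o) (haE : a ≠ Ej) (hwo' : sh w' ≠ sh o) (hwa' : sh w' ≠ sh a) :
    evalD (patOf n₁ n₂ n₃ k) (ruleTD S i j (relC z E) (relC z Ej) (relC z w')) = true := by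
  have hlevE := mem_slab111_iff_lev.1 E.2
  have hlevo := mem_slab111_iff_lev.1 o.2
  have hleva := mem_slab111_iff_lev.1 a.2
  have hro := mem_relNbrs_of_adj (z := z) hoE
  have hra := mem_relNbrs_of_adj (z := z) hEa
  set so := lev (o : Site 3) - lev (E : Site 3) with hso
  set sa := lev (a : Site 3) - lev (E : Site 3) with hsa
  have hso1 : so = 1 ∨ so = -1 := by
    obtain ⟨u, -, hn⟩ := nbr_relC (z := z) hoE; rcases hn with ⟨-, hl⟩ | ⟨-, hl⟩ <;> [left; right] <;> omega
  have hsa1 : sa = 1 ∨ sa = -1 := by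
    obtain ⟨u, -, hn⟩ := nbr_relC (z := z) hEa; rcases hn with ⟨-, hl⟩ | ⟨-, hl⟩ <;> [left; right] <;> omega
  -- window and column facts
  have winB : ∀ {y : slab111 k}, HexShadow.InWin z tD sR ((hexShadow k).sh y) → S.inwinB (relC z y) = true := by
    intro y hy
    rw [hexShadow_sh, sh_eq_vcol_relC z y] at hy
    unfold HexShadow.InWin at hy
    simp only [vcol_apply_zero, vcol_apply_one] at hy
    exact hV.inwin _ (by omega) (by omega)
  have hwo_rel : relC z o ≠ relC z w' := fun e => hwo' (by rw [sh_eq_vcol_relC z w', sh_eq_vcol_relC z o, e])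
  have hwa_rel : relC z a ≠ relC z w' := fun e => hwa' (by rw [sh_eq_vcol_relC z w', sh_eq_vcol_relC z a, e])
  have hoa_rel : (relC z o, so) ≠ (relC z a, sa) := by
    intro e; simp only [Prod.mk.injEq] at e
    exact hao (eq_of_sh_eq_of_lev_eq (by rw [sh_eq_vcol_relC z a, sh_eq_vcol_relC z o, e.1]) (by omega))
  -- the cube of `(o, a)` is in the list and true
  unfold evalD; rw [List.any_eq_true]
  -- the outside clause
  have hout : ∃ cl, outsideC S i (relC z o) so = some cl ∧ (cl ≠ [] → evalC (patOf n₁ n₂ n₃ k) cl = true) := by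
    unfold outsideC
    rcases not_mem_WOf ho with hc | ⟨hl0, hb⟩ | ⟨hlk, hb⟩
    · exact ⟨[], by rw [if_pos hc], fun h => absurd rfl h⟩
    · by_cases hc : S.colsB (relC z o) = false
      · exact ⟨[], by rw [if_pos hc], fun h => absurd rfl h⟩
      · refine ⟨_, by rw [if_neg hc, if_pos (Or.inl hb)], fun _ => ?_⟩
        unfold evalC; rw [List.any_eq_true]
        refine ⟨eq0A i so, by simp [hb], ?_⟩
        exact (bdry_complete h1 h2 h3 hi (x := so) (by omega)).2.2.1 (by unfold LvT.val at hEi ⊢; simp only at hEi ⊢; omega)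
    · by_cases hc : S.colsB (relC z o) = false
      · exact ⟨[], by rw [if_pos hc], fun h => absurd rfl h⟩
      · refine ⟨_, by rw [if_neg hc, if_pos (Or.inr hb)], fun _ => ?_⟩
        unfold evalC; rw [List.any_eq_true]
        refine ⟨eqKA i so, by simp [hb], ?_⟩
        exact (bdry_complete h1 h2 h3 hi (x := so) (by omega)).2.2.2.1 (by unfold LvT.val at hEi ⊢; simp only at hEi ⊢; omega)
  obtain ⟨cl, hcl, hcltrue⟩ := hout
  have hexo : (existsA i so).eval (patOf n₁ n₂ n₃ k) = true := by
    unfold existsA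
    rcases hso1 with e | e
    · rw [if_pos e]; exact (bdry_complete h1 h2 h3 hi (x := 1) (by omega)).2.2.2.2.2 (by unfold LvT.val at hEi ⊢; simp only at hEi ⊢; omega)
    · rw [if_neg (by omega)]; exact (bdry_complete h1 h2 h3 hi (x := -1) (by omega)).2.2.2.2.1 (by unfold LvT.val at hEi ⊢; simp only at hEi ⊢; omega)
  have hexa : (existsA i sa).eval (patOf n₁ n₂ n₃ k) = true := by
    unfold existsA
    rcases hsa1 with e | e
    · rw [if_pos e]; exact (bdry_complete h1 h2 h3 hi (x := 1) (by omega)).2.2.2.2.2 (by unfold LvT.val at hEi ⊢; simp only at hEi ⊢; omega)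
    · rw [if_neg (by omega)]; exact (bdry_complete h1 h2 h3 hi (x := -1) (by omega)).2.2.2.2.1 (by unfold LvT.val at hEi ⊢; simp only at hEi ⊢; omega)
  refine ⟨(if cl = [] then [] else [cl]) ++ [[existsA i so], [existsA i sa]] ++ (if relC z a = relC z Ej then neQ (i, sa) (j, 0) else []), ?_, ?_⟩
  · unfold ruleTD
    rw [List.mem_flatMap]
    refine ⟨(relC z o, so), hro, ?_⟩
    rw [List.mem_flatMap]
    refine ⟨(relC z a, sa), hra, ?_⟩
    have hcond : ¬ ((relC z o, so) = (relC z a, sa) ∨ S.inwinB (relC z o) = false ∨ relC z o = relC z w' ∨ S.inwinB (relC z a) = false ∨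
        relC z a = relC z w') := by
      rintro (h | h | h | h | h)
      · exact hoa_rel h
      · rw [winB hwo] at h; exact Bool.noConfusion h
      · exact hwo_rel h
      · rw [winB hwa] at h; exact Bool.noConfusion h
      · exact hwa_rel h
    simp only [hcond, if_false, hcl]
    exact List.mem_singleton.2 rfl
  · unfold evalQ
    rw [List.all_append, List.all_append, Bool.and_eq_true, Bool.and_eq_true]
    refine ⟨⟨?_, ?_⟩, ?_⟩
    · by_cases hce : cl = []
      · rw [if_pos hce]; rfl
      · rw [if_neg hce]; simpa using hcltrue hce
    · simp only [List.all_cons, List.all_nil, Bool.and_true, Bool.and_eq_true]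
      unfold evalC; simp only [List.any_cons, List.any_nil, Bool.or_false]
      exact ⟨hexo, hexa⟩
    · by_cases hca : relC z a = relC z Ej
      · rw [if_pos hca]
        have hne : LvT.val n₁ n₂ n₃ (i, sa) ≠ LvT.val n₁ n₂ n₃ (j, 0) := by
          intro e
          apply haE
          refine eq_of_sh_eq_of_lev_eq (by rw [sh_eq_vcol_relC z a, sh_eq_vcol_relC z Ej, hca]) ?_
          have : LvT.val n₁ n₂ n₃ (i, sa) = LvT.val n₁ n₂ n₃ (i, 0) + sa := by unfold LvT.val; simp only; ring
          rw [this, hEi, hEj] at e; omega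
        have := neQ_complete (k := k) hi hj hij (x := sa) (by omega) hne
        unfold evalQ at this; exact this
      · rw [if_neg hca]; rfl

/-- **THE RULES HOLD AT THE PATTERN OF A CERTIFIED TRIPLE.** [cite: DuminilCopinSidoraviciusTassion2016, §2.3 (proof of Fact 2: u', v', w')] -/
theorem rulesFm_sound {S : ShapeB} {tR tD sR sD : ℕ} (hV : S.Valid tR tD sR sD) {z : Site 2} {E₁ E₂ w' : slab111 k}
    (hT : (hexShadow k).Terminals 3 z tR tD sR (WOf S k z) E₁ E₂ w') :
    (rulesFm S (relC z E₁) (relC z E₂) (relC z w')).eval (patOf (lev (E₁ : Site 3)) (lev (E₂ : Site 3)) (lev (w' : Site 3)) k) = true := by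
  have b1 := mem_slab111_iff_lev.1 E₁.2
  have b2 := mem_slab111_iff_lev.1 E₂.2
  have b3 := mem_slab111_iff_lev.1 w'.2
  have memS : ∀ {i : ℕ} (hi : i = 1 ∨ i = 2 ∨ i = 3) {x : slab111 k}, x ∈ WOf S k z →
      LvT.val (lev (E₁ : Site 3)) (lev (E₂ : Site 3)) (lev (w' : Site 3)) (i, 0) = lev (x : Site 3) →
      (memFm S i (relC z x)).eval (patOf (lev (E₁ : Site 3)) (lev (E₂ : Site 3)) (lev (w' : Site 3)) k) = true := by
    intro i hi x hx hval
    have hc := (bdry_complete b1 b2 b3 hi (x := 0) (by omega))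
    unfold memFm Fm.eval
    rw [List.all_append, Bool.and_eq_true]
    constructor
    · by_cases hb : S.badBot (relC z x) = true
      · simp only [hb, if_true, List.all_cons, List.all_nil, Bool.and_true]
        unfold evalD evalQ evalC; simp only [List.any_cons, List.all_cons, List.all_nil, List.any_nil, Bool.or_false, Bool.and_true]
        exact hc.1 (by rw [hval]; intro h0; exact hx.2.1 ⟨h0, hb⟩)
      · simp [hb]
    · by_cases hb : S.badTop (relC z x) = true
      · simp only [hb, if_true, List.all_cons, List.all_nil, Bool.and_true]
        unfold evalD evalQ evalC; simp only [List.any_cons, List.all_cons, List.all_nil, List.any_nil, Bool.or_false, Bool.and_true]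
        exact hc.2.1 (by rw [hval]; intro h0; exact hx.2.2 ⟨h0, hb⟩)
      · simp [hb]
  obtain ⟨o₁, a₁, a₂, o₂, hoE1, hEa1, haE2, hEo2, ho1, ho2, hwo1, hwa1w, hwa2w, hwo2, ha1o1, ha1E2, ha2o2, ha2E1, -, -, -, -, hwo1',
    hwa1', hwa2', hwo2'⟩ := hT.nbrs
  unfold rulesFm
  rw [EntryX.eval_append, EntryX.eval_append, EntryX.eval_append, EntryX.eval_append, Bool.and_eq_true, Bool.and_eq_true, Bool.and_eq_true,
    Bool.and_eq_true]
  refine ⟨⟨⟨⟨memS (Or.inl rfl) hT.E₁W (by unfold LvT.val; simp), memS (Or.inr (Or.inl rfl)) hT.E₂W (by unfold LvT.val; simp)⟩,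
    memS (Or.inr (Or.inr rfl)) hT.w'W (by unfold LvT.val; simp)⟩, ?_⟩, ?_⟩
  · by_cases hq : relC z E₁ = relC z E₂
    · rw [if_pos hq]
      unfold Fm.eval; simp only [List.all_cons, List.all_nil, Bool.and_true]
      unfold evalD; simp only [List.any_cons, List.any_nil, Bool.or_false]
      refine neQ_complete (k := k) (Or.inl rfl) (Or.inr (Or.inl rfl)) (by norm_num) (x := 0) (by omega) ?_
      unfold LvT.val; simp only [if_true, show ¬((2:ℕ) = 1) by omega, if_false, add_zero]
      intro e; exact hT.ne (eq_of_sh_eq_of_lev_eq (by rw [sh_eq_vcol_relC z E₁, sh_eq_vcol_relC z E₂, hq]) e)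
    · rw [if_neg hq]; rfl
  · unfold Fm.eval; simp only [List.all_cons, List.all_nil, Bool.and_true, Bool.and_eq_true]
    constructor
    · exact ruleTD_sound hV b1 b2 b3 (Or.inl rfl) (Or.inr (Or.inl rfl)) (by norm_num) (by unfold LvT.val; simp) (by unfold LvT.val; simp)
        hoE1.symm hEa1 ho1 hwo1 hwa1w ha1o1 ha1E2 hwo1' hwa1'
    · exact ruleTD_sound hV b1 b2 b3 (Or.inr (Or.inl rfl)) (Or.inl rfl) (by norm_num) (by unfold LvT.val; simp) (by unfold LvT.val; simp)
        hEo2 haE2.symm ho2 hwo2 hwa2w ha2o2 ha2E1 hwo2' hwa2'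

end Slab111

end Summit.CriticalPhenomena.PercolationContinuityZ3.Theorems.Transplant

end
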